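import Literature.NumberTheory.Automorphic.AutomorphicRepsGLCleanModelArch
import Literature.NumberTheory.Automorphic.AutomorphicRepsGLCuspidalUnitaryHolds
import Literature.NumberTheory.Automorphic.CuspFormsBoundedHC
import Literature.NumberTheory.Automorphic.ArchParameterTwistNorm
import Literature.NumberTheory.Automorphic.AutomorphicRepDataSplitCenter
import Literature.NumberTheory.Automorphic.IdeleNormDetGL
import Literature.NumberTheory.Automorphic.HermitianArchParameter
import Literature.NumberTheory.Automorphic.AdelicGroupDataAutomorphicMeasureProofs
import Literature.NumberTheory.Automorphic.ClozelAlgebraicityCMAssemblyProofs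
import HarnessLib

/-!
# Clozel's purity lemma on multisets, from the Petersson form (proofs)

Topic `NumberTheory/Automorphic`; a proof file (theorems only: no definition, no named fact, no
instance), the automorphic assembly announced in `HermitianArchParameter` ("the automorphic assembly
is `ClozelPurityProofs`").  For a CUSPIDAL Borel–Jacquet datum `π = W / W'` on `GL_n(𝔸_K)`
(`n ≥ 1`, any number field `K`, any `W'`, no algebraicity) with archimedean parameter `χ`
(`AutomorphicRepData.HasArchParameter`: the Harish-Chandra parameters, place by place, of the Lie
algebra action on `W / W'`, indexed by the complex embeddings):

* `CuspidalAutomorphicRepData.archParameter_conjugate_eq_map_neg_conj_add` — **the archimedean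
  parameter of a cuspidal representation is Hermitian-symmetric up to one real shift**: there is
  `c ∈ ℝ` with `χ(ῑ) = {-ā + c : a ∈ χ(ι)}` at every embedding `ι` — Clozel 1990, Lemme 4.9
  (lemme de pureté) in its weight-free form on multisets, i.e. unitarity of `π_∞ ⊗ |det|^{c/2}` read
  on the Harish-Chandra parameter (Knapp–Vogan 1995, Ch. IX §1).
* `CuspidalAutomorphicRepData.purity_of_isCAlgebraic` — for a C-algebraic infinity type `T` of a
  cuspidal `π` (exponents in `(n-1)/2 + ℤ`, hence real) the shift is an INTEGER `w`:
  `{a at ῑ} = {w - a : a at ι}`; `CuspidalAutomorphicRepData.purity` — the same for regular algebraic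
  types: **clause (iii) of the named fact `Clozel1990_regularAlgebraic`, now a theorem** (all `n`).
* (second route, same conclusions with different intermediate statements)
  `CuspidalAutomorphicRepData.archParameter_map_neg_conj_of_clean` — an `A_G`-INVARIANT clean cuspidal
  datum has `χ(ῑ) = {-ā : a ∈ χ(ι)}` (the Petersson form on `W ≅ W / ⊥` directly);
  `CuspidalAutomorphicRepData.purity_of_hasInfinityType` — purity with `w ∈ ℤ` via the REAL twist by
  `|det|^{-s/(n[K:ℚ])}`, `s = ∑_ι ∑_i a_{ι,i}` the `A_G`-exponent read off the infinity type
  (`HasInfinityType.apply_posRealScalar_mul_of_W'_eq_bot`, `ArchParameterSplitCentre`) and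
  `HasArchParameter.of_map_mulChar_detTwist`; `clause_iii`, `clause_iii_rank_zero`.
* `CuspidalAutomorphicRepData.isTotallyReal_or_isCMField_ratField_of_clauses_i_ii`,
  **`Clozel1990_regularAlgebraic_of_clauses_i_ii`** — with clause (iii) a theorem (`purity`) and
  clause (iv) following from (i)–(iii) (`Clozel1990_regularAlgebraic_of_clauses`,
  `ClozelAlgebraicityCMAssemblyProofs`), the named fact `Clozel1990_regularAlgebraic` follows from its
  clauses (i) and (ii) alone, i.e. from Clozel 1990, Thm. 3.13 proper (`ℚ(π_f)` a number field and the
  cuspidal `Aut(ℂ)`-conjugates `^σπ` with infinity types `^σT` — the `ℚ`-structure of cuspidal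
  cohomology, not in the tree); and clause (iv) for one `π` from (i), (ii) (Patrikis 2019, Cor. 3.2.3).

Proof of the first theorem (Borel–Jacquet 1979, 5.7 "we may assume `π` unitary" + Knapp–Vogan IX §1),
entirely from proved pieces of the tree.  (1) Pass to a clean model `π₀ = W₀ / ⊥` with the same
parameter (`exists_clean_hasSatakeParamAt_hasArchParameter_of_sSup_irreducible`, semisimplicity
`stable_cuspidal_eq_sSup_irreducible_holds`).  (2) `A_G` acts on `W₀` by `a ↦ a^μ`
(`exists_apply_posRealScalar_mul_eq_cpow`); with `s = -μ/(n[K:ℚ])` the COMPLEX twist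
`W₁ = W₀ ⊗ |det|^s` is a clean cuspidal datum of `A_G`-invariant forms
(`exists_cuspidalAutomorphicRepData_map_mulChar_detTwist`, `mulChar_detTwist_apply_posRealScalar_mul_of_cpow`
— verbatim the normalisation of `StrongMultiplicityOneRepData`), hence `W₁ ≤ bddInvariant`
(`cuspidal_bounded_holds`, `le_bddInvariant_of_cuspidal_bounded`) carries the Petersson form
`⟪·,·⟫_μ` (`l2Pairing`), positive definite (`eq_zero_of_l2Pairing_self_eq_zero`) with `𝔤` acting
skew-symmetrically (`l2Pairing_lieDeriv_add_eq_zero`).  (3) The parameter of the complex twist is NOT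
computed (the Harish-Chandra shift by a complex scalar character is not in the tree); instead the form is
PULLED BACK along `e : W₀/⊥ ≃ W₁/⊥` (`exists_quotEquiv_of_map_mulChar`), where the Lie algebra acts by
`X ↦ ρ₀ X + s λ(X)` (`lieRep_mulChar_twist`, proved for complex `s`): for `B(u, v) = ⟪e u, e v⟫` one gets
`B(ρ₀ X u, v) + B(u, ρ₀ X v) = -2 re(s) λ(X) B(u, v)`, so `B` is `𝔤`-skew-Hermitian for the REAL shift
`ρ'' = ρ₀ + re(s) λ · 1`, whose parameter is `χ + re s` (`HasHCParameter.of_twist_norm`, real).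
(4) `HasArchParameter.map_neg_conj_of_skewHermitian` gives `χ(ῑ) + re s = {-conj(a + re s)}`, i.e. the
claim with `c = -2 re s`.

## References

* L. Clozel, *Motifs et formes automorphes: applications du principe de fonctorialité*, in
  Automorphic forms, Shimura varieties, and L-functions I (Ann Arbor 1988), Academic Press 1990,
  Lemme 4.9. [Clozel1990]
* A. W. Knapp, D. A. Vogan, *Cohomological Induction and Unitary Representations* (1995), Ch. IX §1,
  p. 597. [KnappVogan1995]
* A. Borel, H. Jacquet, *Automorphic forms and automorphic representations*, Corvallis 1979, §4.6
  and 5.7. [BorelJacquetCorvallis1979]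
* S. Patrikis, *Variations on a theorem of Tate*, Mem. AMS 258 (2019) = arXiv:1207.6724, Cor. 3.2.3.
  [Patrikis2019]
-/

-- Mathlib idiom (Mathlib/Algebra/Lie/OfAssociative.lean): the commutator bracket on associative rings;
-- needed to state `𝔤𝔩ₙ(K_∞) →ₗ⁅ℝ⁆ End V` (as in `HarishChandraGL`, `ArchParameterTwistNorm`)
attribute [local instance 100] LieRing.ofAssociativeRing

open scoped Matrix Classical ComplexConjugate NNReal

noncomputable section

namespace Literature.NumberTheory.Automorphic

open MeasureTheory

/-! ### Twisting a Lie algebra representation by a real scalar character (any real Lie algebra) -/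

section LieTwist

/-- **Twist of a Lie algebra action by a real scalar character** (any real Lie algebra `L`): for
`ρ : L → End_ℂ V` and a real linear form `δ` on `L` vanishing on brackets, `X ↦ ρ X + δ(X) · 1` is a
Lie algebra homomorphism (scalars are central).  The `𝔤𝔩ₙ(𝕜)` case is
`exists_lieHom_add_real_smul_one` of `HarishChandraGLTwist`. Dixmier, *Enveloping Algebras*, 2.2.
[folklore] -/
theorem LieHom.exists_add_real_smul_one {L : Type*} [LieRing L] [LieAlgebra ℝ L]
    {V : Type*} [AddCommGroup V] [Module ℂ V] (ρ : L →ₗ⁅ℝ⁆ Module.End ℂ V)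
    (δ : L →ₗ[ℝ] ℝ) (hδ : ∀ X Y : L, δ ⁅X, Y⁆ = 0) :
    ∃ ρ' : L →ₗ⁅ℝ⁆ Module.End ℂ V, ∀ X, ρ' X = ρ X + ((δ X : ℝ) : ℂ) • (1 : Module.End ℂ V) :=
  -- the `B := Module.End ℂ V` instance of `exists_lieHom_add_algebraMap` (ArchimedeanCharacterTwist);
  -- `algebraMap ℝ (Module.End ℂ V) (δ X)` unfolds to `((δ X : ℝ) : ℂ) • 1` (librarian dedup-01548)
  exists_lieHom_add_algebraMap ρ δ hδ

end LieTwist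

/-! ### The Hermitian symmetry of the archimedean parameter of a cuspidal representation -/

section Hermitian

open _root_.NumberField _root_.NumberField.InfinitePlace _root_.NumberField.mixedEmbedding
open Literature.NumberTheory.GaloisRepresentations (HeckeCharacter ideleGroup)

variable {n : ℕ} {K : Type} [Field K] [NumberField K] {hcpt : isCompact_glFiniteIntegralLevel n K}

/-- Multiset bookkeeping: `s.map (· + t) = (r.map (· + t)).map (-conj ·)` with `t` real gives
`s = r.map (-conj · + (-2t))`. [folklore] -/
private theorem multiset_eq_of_map_add_real {s r : Multiset ℂ} {t : ℝ}
    (h : s.map (· + (t : ℂ)) = (r.map (· + (t : ℂ))).map fun a => -conj a) :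
    s = r.map fun a => -conj a + ((-2 * t : ℝ) : ℂ) := by
  have h2 := congrArg (Multiset.map fun x : ℂ => x - (t : ℂ)) h
  simp only [Multiset.map_map, Function.comp_def, add_sub_cancel_right, Multiset.map_id'] at h2
  rw [h2]
  refine Multiset.map_congr rfl fun a _ => ?_
  rw [map_add, Complex.conj_ofReal]
  push_cast
  ring

-- the Borel–Jacquet carriers (`AutomorphyDatum.gl`, `W / W'`, `𝔤𝔩ₙ(K_∞)`) are large terms: the
-- statement and the bookkeeping below exceed the default budget (as in `ArchParameterTwistNorm`)
set_option maxHeartbeats 800000 in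
/-- **The Petersson form pulled back along a norm twist.**  Let `π₀`, `π₁` be cuspidal Borel–Jacquet
data on `GL_n(𝔸_K)` with `W₁ = W₀ ⊗ |det|^s`, `W₁' = W₀' ⊗ |det|^s` (`s ∈ ℂ`, `η = ‖·‖^s`), `W₁' = ⊥`
and `W₁` consisting of bounded continuous `A_G GL_n(K)`-invariant functions (so that `W₁` carries the
Petersson form `⟪·,·⟫_μ` of an automorphic measure `μ`), and let `ρ` be the Lie algebra action of `π₀`.
Then `B(u, v) := ⟪e u, e v⟫_μ` (`e : W₀/W₀' ≃ W₁/⊥ ≃ W₁`, `exists_quotEquiv_of_map_mulChar`) is a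
sesquilinear form on `W₀ / W₀'`, non-degenerate on the diagonal, with
`B(ρ X u, v) + B(u, ρ X v) = -(s + s̄) λ(X) B(u, v)` — the skew-symmetry of `𝔤` for `⟪·,·⟫_μ`
(`l2Pairing_lieDeriv_add_eq_zero`) transported along `X (|det|^s φ) = |det|^s (X φ + s λ(X) φ)`
(`lieRep_mulChar_twist`). Knapp–Vogan 1995, Ch. IX §1; Borel–Jacquet 1979, 5.7.
[cite: KnappVogan1995, Ch. IX §1 (p. 597)] [cite: BorelJacquetCorvallis1979, 5.7] -/
theorem CuspidalAutomorphicRepData.exists_skewForm_of_twist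
    {π₀ π₁ : CuspidalAutomorphicRepData n K hcpt} {η : HeckeCharacter K} {s : ℂ}
    (hη : ∀ x : ideleGroup K, ((η x : ℂˣ) : ℂ) = (GaloisRepresentations.ideleNorm x : ℂ) ^ s)
    (h1W : π₁.1.W = π₀.1.W.map (mulChar (detTwist n η)))
    (h1W' : π₁.1.W' = π₀.1.W'.map (mulChar (detTwist n η))) (h1bot : π₁.1.W' = ⊥)
    (hbdd : π₁.1.W ≤ (AdelicGroupData.gl n K).bddInvariant)
    {ρ𝔤 : (AutomorphyDatum.gl n K hcpt).arch.lie →ₗ⁅ℝ⁆ Module.End ℂ π₀.1.Quot}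
    (hρ : π₀.1.HasLieAction ρ𝔤) {lam : (AutomorphyDatum.gl n K hcpt).arch.lie →ₗ[ℝ] ℝ}
    (hlam : ∀ X : (AutomorphyDatum.gl n K hcpt).arch.lie,
      lam X = (∑ w, (X : Matrix (Fin n) (Fin n) (mixedSpace K)).trace.1 w) +
        ∑ w, 2 * ((X : Matrix (Fin n) (Fin n) (mixedSpace K)).trace.2 w).re) :
    ∃ B : π₀.1.Quot → π₀.1.Quot → ℂ,
      (∀ u v w, B (u + v) w = B u w + B v w) ∧ (∀ u v w, B u (v + w) = B u v + B u w) ∧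
      (∀ (c : ℂ) v w, B (c • v) w = c * B v w) ∧ (∀ (c : ℂ) v w, B v (c • w) = conj c * B v w) ∧
      (∀ (X : (AutomorphyDatum.gl n K hcpt).arch.lie) (u v : π₀.1.Quot),
        B (ρ𝔤 X u) v + B u (ρ𝔤 X v) = -((s + conj s) * (lam X : ℂ)) * B u v) ∧
      ∃ v, B v v ≠ 0 := by
  classical
  obtain ⟨μm, hμm⟩ := AdelicGroupData.exists_isAutomorphicMeasure_gl_holds n K
  haveI := hμm
  -- the quotient isomorphism `e : W₀/W₀' ≃ W₁/⊥` and the Lie algebra on the twist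
  obtain ⟨e, he⟩ := AutomorphicRepData.exists_quotEquiv_of_map_mulChar (detTwist n η) h1W h1W'
  have hrel := fun X v => AutomorphicRepData.lieRep_mulChar_twist hη h1W he hρ hlam X v
  -- `W₁ / ⊥ ≃ W₁`
  have hker : π₁.1.kerQuot = ⊥ := by
    rw [AutomorphicRepData.kerQuot, h1bot, Submodule.comap_bot, Submodule.ker_subtype]
  obtain ⟨out₁, hout_mk⟩ : ∃ out₁ : π₁.1.Quot ≃ₗ[ℂ] π₁.1.W, ∀ ψ : π₁.1.W, out₁ (π₁.1.mkQ ψ) = ψ :=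
    ⟨π₁.1.kerQuot.quotEquivOfEqBot hker, fun ψ =>
      Submodule.quotEquivOfEqBot_apply_mk (p := π₁.1.kerQuot) hker ψ⟩
  have hmk_out : ∀ q : π₁.1.Quot, π₁.1.mkQ (out₁ q) = q := fun q => by
    induction q using Submodule.Quotient.induction_on with
    | H ψ => exact congrArg π₁.1.mkQ (hout_mk ψ)
  -- the realisation `F u ∈ W₁` of `u ∈ W₀ / W₀'`
  obtain ⟨F, hFmem, hFdef⟩ : ∃ F : π₀.1.Quot → ((AdelicGroupData.gl n K).Adelic → ℂ),
      (∀ u, F u ∈ π₁.1.W) ∧ ∀ u, F u = ((out₁ (e u) : π₁.1.W) : (AdelicGroupData.gl n K).Adelic → ℂ) :=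
    ⟨fun u => ((out₁ (e u) : π₁.1.W) : (AdelicGroupData.gl n K).Adelic → ℂ), fun u => (out₁ (e u)).2,
      fun u => rfl⟩
  have hFadd : ∀ u v, F (u + v) = F u + F v := fun u v => by
    rw [hFdef, hFdef, hFdef, map_add, map_add, Submodule.coe_add]
  have hFsmul : ∀ (c : ℂ) u, F (c • u) = c • F u := fun c u => by
    rw [hFdef, hFdef, map_smul, map_smul, Submodule.coe_smul]
  -- the Lie derivative of `F u`: `X (F u) = F (ρ X u) + s λ(X) F u`
  have hlie : ∀ (X : (AutomorphyDatum.gl n K hcpt).arch.lie) (u : π₀.1.Quot),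
      lieDeriv (AutomorphyDatum.gl n K hcpt).ofArch X (F u) = F (ρ𝔤 X u) + (s * (lam X : ℂ)) • F u := by
    intro X u
    have h1 : out₁ (e (ρ𝔤 X u + (s * (lam X : ℂ)) • u)) = π₁.1.lieDerivW X (out₁ (e u)) := by
      rw [← hrel X u, ← hmk_out (e u), π₁.1.lieRep_mkQ, hout_mk, hmk_out]
    have h2 : ((π₁.1.lieDerivW X (out₁ (e u)) : π₁.1.W) : (AdelicGroupData.gl n K).Adelic → ℂ) =
        lieDeriv (AutomorphyDatum.gl n K hcpt).ofArch X ((out₁ (e u) : π₁.1.W) : _ → ℂ) := rfl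
    rw [← hFsmul, ← hFadd, hFdef, hFdef, ← h2, ← h1]
  -- the pulled-back Petersson form
  have hbF : ∀ u, F u ∈ (AdelicGroupData.gl n K).bddInvariant := fun u => hbdd (hFmem u)
  obtain ⟨B, hB⟩ : ∃ B : π₀.1.Quot → π₀.1.Quot → ℂ,
      ∀ u v, B u v = (AdelicGroupData.gl n K).l2Pairing μm (F u) (F v) := ⟨_, fun _ _ => rfl⟩
  refine ⟨B, fun u v w => ?_, fun u v w => ?_, fun c v w => ?_, fun c v w => ?_, fun X u v => ?_, ?_⟩
  · rw [hB, hB, hB, hFadd]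
    exact AdelicGroupData.l2Pairing_add_left (hbF u) (hbF v) (hbF w)
  · rw [hB, hB, hB, hFadd]
    exact AdelicGroupData.l2Pairing_add_right (hbF u) (hbF v) (hbF w)
  · rw [hB, hB, hFsmul]
    exact AdelicGroupData.l2Pairing_smul_left c _ _
  · rw [hB, hB, hFsmul]
    exact AdelicGroupData.l2Pairing_smul_right c _ _
  · -- skewness of `𝔤` for the Petersson form, transported
    have hXφ : lieDeriv (AutomorphyDatum.gl n K hcpt).ofArch X (F u) ∈
        (AdelicGroupData.gl n K).bddInvariant := hbdd (π₁.1.stable.lie_stable X _ (hFmem u))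
    have hXψ : lieDeriv (AutomorphyDatum.gl n K hcpt).ofArch X (F v) ∈
        (AdelicGroupData.gl n K).bddInvariant := hbdd (π₁.1.stable.lie_stable X _ (hFmem v))
    have hsk := (AutomorphyDatum.gl n K hcpt).l2Pairing_lieDeriv_add_eq_zero (μ := μm) X (hbF u) (hbF v)
      (π₁.1.isArchSmooth_of_mem_W (hFmem u)) (π₁.1.isArchSmooth_of_mem_W (hFmem v)) hXφ hXψ
    rw [hlie X u, hlie X v,
      AdelicGroupData.l2Pairing_add_left (hbF _) (Submodule.smul_mem _ _ (hbF u)) (hbF v),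
      AdelicGroupData.l2Pairing_add_right (hbF u) (hbF _) (Submodule.smul_mem _ _ (hbF v)),
      AdelicGroupData.l2Pairing_smul_left, AdelicGroupData.l2Pairing_smul_right, map_mul,
      Complex.conj_ofReal] at hsk
    simp only [hB]
    linear_combination hsk
  · -- a vector of non-zero norm
    obtain ⟨φ, hφW, hφ0⟩ : ∃ φ ∈ π₁.1.W, φ ≠ 0 := by
      obtain ⟨φ, hφW, hφW'⟩ := SetLike.exists_of_lt π₁.1.lt
      rw [h1bot] at hφW'
      exact ⟨φ, hφW, fun h => hφW' (h ▸ Submodule.zero_mem _)⟩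
    refine ⟨e.symm (π₁.1.mkQ ⟨φ, hφW⟩), fun h => ?_⟩
    rw [hB, hFdef, LinearEquiv.apply_symm_apply, hout_mk] at h
    exact hφ0 (AdelicGroupData.eq_zero_of_l2Pairing_self_eq_zero (hbdd hφW) h)

/-- **From a skew form to Hermitian symmetry of the parameter (algebraic half).**  Let `ρ` be a real
Lie algebra representation of `𝔤 = 𝔤𝔩ₙ(K_∞)` on `V` with archimedean parameter `χ`, and `B` a
sesquilinear form on `V`, non-zero on the diagonal, with
`B(ρ X u, v) + B(u, ρ X v) = -(s + s̄) λ(X) B(u, v)` for the norm exponent `λ`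
(`λ(X) = ∑_{w real} tr X_w + ∑_{w complex} 2 re tr X_w`).  Then `χ(ῑ) = {-ā - 2 re s : a ∈ χ(ι)}`:
`B` is `𝔤`-skew-Hermitian for the REAL shift `ρ'' = ρ + re(s) λ · 1`, whose parameter is `χ + re s`
(`HasHCParameter.of_twist_norm`), and `HasArchParameter.map_neg_conj_of_skewHermitian` applies to
`ρ''`. Knapp–Vogan 1995, Ch. IX §1; Borel–Jacquet 1979, 5.7. [cite: KnappVogan1995, Ch. IX §1 (p. 597)] -/
theorem HasArchParameter.conjugate_eq_of_skewForm {V : Type*} [AddCommGroup V] [Module ℂ V]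
    {ρ𝔤 : (AutomorphyDatum.gl n K hcpt).arch.lie →ₗ⁅ℝ⁆ Module.End ℂ V} {χ : (K →+* ℂ) → Multiset ℂ}
    (habs : HasArchParameter
      (ρ𝔤.comp (LieSubalgebra.topEquiv :
        (⊤ : LieSubalgebra ℝ (Matrix (Fin n) (Fin n) (mixedSpace K))) ≃ₗ⁅ℝ⁆
          Matrix (Fin n) (Fin n) (mixedSpace K)).symm.toLieHom) χ)
    {lam : (AutomorphyDatum.gl n K hcpt).arch.lie →ₗ[ℝ] ℝ}
    (hlam0 : ∀ X Y : (AutomorphyDatum.gl n K hcpt).arch.lie, lam ⁅X, Y⁆ = 0)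
    (hlam : ∀ X : (AutomorphyDatum.gl n K hcpt).arch.lie,
      lam X = (∑ w, (X : Matrix (Fin n) (Fin n) (mixedSpace K)).trace.1 w) +
        ∑ w, 2 * ((X : Matrix (Fin n) (Fin n) (mixedSpace K)).trace.2 w).re)
    {s : ℂ} (B : V → V → ℂ) (hadd₁ : ∀ u v w, B (u + v) w = B u w + B v w)
    (hadd₂ : ∀ u v w, B u (v + w) = B u v + B u w)
    (hsmul₁ : ∀ (c : ℂ) v w, B (c • v) w = c * B v w)
    (hsmul₂ : ∀ (c : ℂ) v w, B v (c • w) = conj c * B v w)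
    (hpair : ∀ (X : (AutomorphyDatum.gl n K hcpt).arch.lie) (u v : V),
      B (ρ𝔤 X u) v + B u (ρ𝔤 X v) = -((s + conj s) * (lam X : ℂ)) * B u v)
    {v₀ : V} (hv : B v₀ v₀ ≠ 0) (ι : K →+* ℂ) :
    χ (ComplexEmbedding.conjugate ι) = (χ ι).map fun a => -conj a + ((-2 * s.re : ℝ) : ℂ) := by
  -- the real shift `ρ'' = ρ + re(s) λ · 1` on `𝔤𝔩ₙ(K_∞)`
  obtain ⟨ψ, hψ⟩ : ∃ ψ : Matrix (Fin n) (Fin n) (mixedSpace K) →ₗ⁅ℝ⁆ (AutomorphyDatum.gl n K hcpt).arch.lie,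
      ψ = (LieSubalgebra.topEquiv : (⊤ : LieSubalgebra ℝ (Matrix (Fin n) (Fin n) (mixedSpace K))) ≃ₗ⁅ℝ⁆
        Matrix (Fin n) (Fin n) (mixedSpace K)).symm.toLieHom := ⟨_, rfl⟩
  rw [← hψ] at habs
  obtain ⟨Λ, hΛapply⟩ : ∃ Λ : Matrix (Fin n) (Fin n) (mixedSpace K) →ₗ[ℝ] ℝ, ∀ Y, Λ Y = lam (ψ Y) :=
    ⟨lam.comp (ψ : Matrix (Fin n) (Fin n) (mixedSpace K) →ₗ[ℝ] _), fun Y => rfl⟩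
  obtain ⟨t, ht⟩ : ∃ t : ℝ, t = s.re := ⟨_, rfl⟩
  have hδ : ∀ X Y : Matrix (Fin n) (Fin n) (mixedSpace K), (t • Λ) ⁅X, Y⁆ = 0 := fun X Y => by
    rw [LinearMap.smul_apply, hΛapply, LieHom.map_lie, hlam0, smul_zero]
  obtain ⟨ρ'', hρ''⟩ := LieHom.exists_add_real_smul_one (ρ𝔤.comp ψ) (t • Λ) hδ
  have hρ''apply : ∀ (Y : Matrix (Fin n) (Fin n) (mixedSpace K)) (u : V),
      ρ'' Y u = ρ𝔤 (ψ Y) u + ((t * Λ Y : ℝ) : ℂ) • u := fun Y u => by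
    rw [hρ'', LinearMap.add_apply, LinearMap.smul_apply, Module.End.one_apply, LinearMap.smul_apply,
      smul_eq_mul, LieHom.comp_apply]
  -- its archimedean parameter is `χ + re s`
  have hA : HasArchParameter ρ'' fun σ => (χ σ).map (· + (t : ℂ)) := by
    obtain ⟨hreal, hcx⟩ := habs
    refine ⟨fun w => ?_, fun w => ?_⟩
    · refine HasHCParameter.of_twist_norm (𝕜 := ℝ) t (LinearEquiv.refl ℂ _) (fun Y v => ?_) (hreal w)
      have key : Λ (realPlaceLie n w Y) = (Fintype.card (ℝ →ₐ[ℝ] ℂ) : ℝ) * RCLike.re Y.trace := by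
        rw [hΛapply, hlam, HCEmb.card_algHom_of_I_eq_zero (𝕜 := ℝ) (by simp), Nat.cast_one, one_mul,
          RCLike.re_to_real, hψ]
        exact normExponent_realPlaceLie w Y
      rw [LinearEquiv.refl_apply, LinearEquiv.refl_apply, LieHom.comp_apply, hρ''apply, key]
      rfl
    · refine HasHCParameter.of_twist_norm (𝕜 := ℂ) t (LinearEquiv.refl ℂ _) (fun Y v => ?_) (hcx w)
      have key : Λ (complexPlaceLie n w Y) = (Fintype.card (ℂ →ₐ[ℝ] ℂ) : ℝ) * RCLike.re Y.trace := by
        rw [hΛapply, hlam, HCEmb.card_algHom_of_im_I (𝕜 := ℂ) (by simp), Nat.cast_ofNat,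
          RCLike.re_eq_complex_re, hψ]
        exact normExponent_complexPlaceLie w Y
      rw [LinearEquiv.refl_apply, LinearEquiv.refl_apply, LieHom.comp_apply, hρ''apply, key]
      rfl
  -- `ρ''` is skew-Hermitian for `B`
  have hskew : ∀ (Y : Matrix (Fin n) (Fin n) (mixedSpace K)) u v, B (ρ'' Y u) v = -B u (ρ'' Y v) := by
    intro Y u v
    have hp := hpair (ψ Y) u v
    have hsc : s + conj s = ((2 * t : ℝ) : ℂ) := by rw [ht]; exact Complex.add_conj s
    rw [hsc, ← hΛapply] at hp
    rw [hρ''apply, hρ''apply, hadd₁, hadd₂, hsmul₁, hsmul₂, Complex.conj_ofReal]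
    push_cast at hp ⊢
    linear_combination hp
  -- Hermitian symmetry of the shifted parameter, and unshift
  have key := HasArchParameter.map_neg_conj_of_skewHermitian hA B hadd₁ hadd₂ hsmul₁ hsmul₂ hskew hv ι
  rw [ht] at key
  exact multiset_eq_of_map_add_real key

/-- **The archimedean parameter of a cuspidal automorphic representation is Hermitian-symmetric up
to a real shift** (Clozel 1990, Lemme 4.9, weight-free form on multisets; Knapp–Vogan 1995, Ch. IX
§1).  For a cuspidal Borel–Jacquet datum `π` on `GL_n(𝔸_K)`, `n ≥ 1`, with archimedean parameter
`χ`, there is ONE real `c` with `χ(ῑ) = {-ā + c : a ∈ χ(ι)}` for every complex embedding `ι`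
(`c = -2 re s` for the exponent `s` normalising the split component).  See the module docstring for
the proof. [cite: Clozel1990, Lemme 4.9] [cite: KnappVogan1995, Ch. IX §1 (p. 597)] -/
theorem CuspidalAutomorphicRepData.archParameter_conjugate_eq_map_neg_conj_add [NeZero n]
    (π : CuspidalAutomorphicRepData n K hcpt) {χ : (K →+* ℂ) → Multiset ℂ}
    (hχ : π.1.HasArchParameter χ) :
    ∃ c : ℝ, ∀ ι : K →+* ℂ,
      χ (ComplexEmbedding.conjugate ι) = (χ ι).map fun a => -conj a + (c : ℂ) := by
  classical
  -- (1) a clean model with the same archimedean parameter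
  obtain ⟨π₀, h0, -, h0arch⟩ :=
    π.exists_clean_hasSatakeParamAt_hasArchParameter_of_sSup_irreducible
      AutomorphicRepsGL.stable_cuspidal_eq_sSup_irreducible_holds
  obtain ⟨ρ𝔤, hρ, habs⟩ := h0arch χ hχ
  -- (2) `A_G` acts on `W₀` by `a^μ`; the `A_G`-invariant complex twist `π₁ = π₀ ⊗ |det|^s`
  obtain ⟨μ, hμ⟩ := π₀.1.exists_apply_posRealScalar_mul_eq_cpow h0
  have hnd : ((n * Module.finrank ℚ K : ℕ) : ℂ) ≠ 0 := by
    exact_mod_cast (Nat.mul_ne_zero (NeZero.ne n) Module.finrank_pos.ne')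
  obtain ⟨s, hs⟩ : ∃ s : ℂ, s * (n * Module.finrank ℚ K : ℕ) = -μ :=
    ⟨-μ / (n * Module.finrank ℚ K : ℕ), div_mul_cancel₀ _ hnd⟩
  obtain ⟨η, hη⟩ := exists_heckeCharacter_ideleNorm_cpow K s
  obtain ⟨π₁, h1W, h1W'⟩ := exists_cuspidalAutomorphicRepData_map_mulChar_detTwist hη π₀
  have h1bot : π₁.1.W' = ⊥ := by rw [h1W', h0, Submodule.map_bot]
  have hAG : ∀ φ ∈ π₁.1.W, ∀ z ∈ (AdelicGroupData.gl n K).center', ∀ g, φ (z * g) = φ g := by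
    intro φ hφ z hz g
    rw [h1W] at hφ
    obtain ⟨φ₀, hφ₀, rfl⟩ := hφ
    obtain ⟨t, rfl⟩ := hz
    exact mulChar_detTwist_apply_posRealScalar_mul_of_cpow hη hs (hμ φ₀ hφ₀) t g
  -- (3) `W₁` carries the Petersson form; pull it back to `W₀ / ⊥`
  have hbdd : π₁.1.W ≤ (AdelicGroupData.gl n K).bddInvariant :=
    AutomorphicRepsGL.le_bddInvariant_of_cuspidal_bounded AutomorphicRepsGL.cuspidal_bounded_holds
      π₁.2 hAG
  obtain ⟨lam, hlam0, hlam⟩ := exists_normExponent hcpt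
  obtain ⟨B, hadd₁, hadd₂, hsmul₁, hsmul₂, hpair, v₀, hv⟩ :=
    CuspidalAutomorphicRepData.exists_skewForm_of_twist hη h1W h1W' h1bot hbdd hρ hlam
  -- (4) the algebraic half
  exact ⟨-2 * s.re, fun ι =>
    HasArchParameter.conjugate_eq_of_skewForm habs hlam0 hlam B hadd₁ hadd₂ hsmul₁ hsmul₂ hpair hv ι⟩

/-- **Clozel's purity lemma on multisets for C-algebraic cuspidal representations** (Clozel 1990,
Lemme 4.9, as read by `HasInfinityType`): if a cuspidal `π` on `GL_n(𝔸_K)` has a C-algebraic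
infinity type `T` (exponents in `(n-1)/2 + ℤ`, in particular REAL), there is ONE `w ∈ ℤ` with
`{a-multiset of T at ῑ} = {w − a : a ∈ a-multiset of T at ι}` for every embedding `ι` (for `n = 0`
both sides are empty; for `n ≥ 1` take the real shift `c` of
`archParameter_conjugate_eq_map_neg_conj_add`: `c - a` is again an exponent, so `c ∈ ℤ`).
[cite: Clozel1990, Lemme 4.9] -/
theorem CuspidalAutomorphicRepData.purity_of_isCAlgebraic (π : CuspidalAutomorphicRepData n K hcpt)
    {T : InfinityType K n} (hT : π.1.HasInfinityType T) (hC : T.IsCAlgebraic) :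
    ∃ w : ℤ, ∀ ι : K →+* ℂ, (T (ComplexEmbedding.conjugate ι)).map ArchWeight.a =
      ((T ι).map ArchWeight.a).map fun a => (w : ℂ) - a := by
  rcases Nat.eq_zero_or_pos n with hn | hn
  · subst hn
    refine ⟨0, fun ι => ?_⟩
    rw [Multiset.card_eq_zero.mp (hT.1.1 ι), Multiset.card_eq_zero.mp (hT.1.1 _)]
    rfl
  haveI : NeZero n := ⟨hn.ne'⟩
  obtain ⟨c, hc⟩ := π.archParameter_conjugate_eq_map_neg_conj_add hT.2
  -- the exponents are real half-integers `k + (n-1)/2`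
  have hhalf : ∀ ι : K →+* ℂ, ∀ x ∈ (T ι).map ArchWeight.a, ∃ k : ℤ, x = k + ((n : ℂ) - 1) / 2 := by
    intro ι x hx
    obtain ⟨P, hP, rfl⟩ := Multiset.mem_map.mp hx
    obtain ⟨k, l, hk, -⟩ := hC ι P hP
    exact ⟨k, hk⟩
  have hreal : ∀ ι : K →+* ℂ, ∀ x ∈ (T ι).map ArchWeight.a, conj x = x := by
    intro ι x hx
    obtain ⟨k, rfl⟩ := hhalf ι x hx
    rw [map_add, map_div₀, map_sub, map_intCast, map_natCast, map_one, map_ofNat]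
  -- `c` is an integer: read it at one embedding and one exponent
  obtain ⟨ι₀⟩ : Nonempty (K →+* ℂ) := ⟨(Classical.arbitrary (InfinitePlace K)).embedding⟩
  have hcard : Multiset.card ((T ι₀).map ArchWeight.a) = n := by rw [Multiset.card_map, hT.1.1 ι₀]
  obtain ⟨a₀, ha₀⟩ : ∃ a, a ∈ (T ι₀).map ArchWeight.a :=
    Multiset.card_pos_iff_exists_mem.mp (by rw [hcard]; exact hn)
  obtain ⟨k₀, hk₀⟩ := hhalf ι₀ a₀ ha₀
  have hmem : -conj a₀ + (c : ℂ) ∈ (T (ComplexEmbedding.conjugate ι₀)).map ArchWeight.a := by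
    rw [hc ι₀]
    exact Multiset.mem_map_of_mem _ ha₀
  obtain ⟨m₀, hm₀⟩ := hhalf _ _ hmem
  rw [hreal ι₀ a₀ ha₀, hk₀] at hm₀
  have hcZ : (c : ℂ) = ((m₀ + k₀ + ((n : ℤ) - 1) : ℤ) : ℂ) := by
    push_cast
    linear_combination hm₀
  refine ⟨m₀ + k₀ + ((n : ℤ) - 1), fun ι => ?_⟩
  rw [hc ι]
  refine Multiset.map_congr rfl fun x hx => ?_
  rw [hreal ι x hx, hcZ]
  ring

/-- **Clause (iii) of `Clozel1990_regularAlgebraic`, unconditionally** (Clozel 1990, Lemme 4.9 on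
multisets, for every `n`): a regular algebraic infinity type `T` of a cuspidal `π` on `GL_n(𝔸_K)` is
pure — `{a at c∘ι} = {w − a : a at ι}` for one `w ∈ ℤ`. [cite: Clozel1990, Lemme 4.9] -/
theorem CuspidalAutomorphicRepData.purity (π : CuspidalAutomorphicRepData n K hcpt)
    {T : InfinityType K n} (hT : π.1.HasInfinityType T) (hreg : T.IsRegularAlgebraic) :
    ∃ w : ℤ, ∀ ι : K →+* ℂ, (T ((starRingEnd ℂ).comp ι)).map ArchWeight.a =
      ((T ι).map ArchWeight.a).map fun a => (w : ℂ) - a :=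
  π.purity_of_isCAlgebraic hT hreg.1

end Hermitian


/-! ## Second route (parallel, kept for its intermediate statements): the real twist read through
the infinity type (`ArchParameterSplitCentre`), the form on `W ≅ W / ⊥` -/

section SecondRoute

open _root_.NumberField _root_.IsDedekindDomain
open Literature.NumberTheory.GaloisRepresentations (HeckeCharacter ideleGroup)

variable {n : ℕ} {K : Type} [Field K] [NumberField K] {hcpt : isCompact_glFiniteIntegralLevel n K}

/-! ### A clean `A_G`-invariant cuspidal datum has a Hermitian-symmetric archimedean parameter -/

section Clean

/-- **The archimedean parameter of an `A_G`-invariant clean cuspidal datum is Hermitian-symmetric**: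
`χ(σ̄) = {-ā : a ∈ χ(σ)}` at every complex embedding `σ`. Let `π = W / ⊥` be cuspidal on
`GL_n(𝔸_K)` with `A_G`-invariant forms and archimedean parameter `χ` (Lie action `ρ` on
`W / ⊥ ≅ W`). The Petersson pairing `⟪φ, ψ⟫_μ` (an automorphic measure `μ`,
`exists_isAutomorphicMeasure_gl_holds`; defined on `W` because `A_G`-invariant cusp forms are
bounded, `cuspidal_bounded_holds`) is a sesquilinear form on `W` with `⟪φ, φ⟫ ≠ 0` for `φ ≠ 0`
(`eq_zero_of_l2Pairing_self_eq_zero`) for which `𝔤 = 𝔤𝔩_n(K_∞)` acts by skew-Hermitian operators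
(`l2Pairing_lieDeriv_add_eq_zero`: invariance of `μ` under the one-parameter groups of `G_∞`). So
`HasArchParameter.map_neg_conj_of_skewHermitian` (antipode adjointness, `γ(S z)(x) = γ(z)(-x)`,
reality of `γ`, uniqueness of Harish-Chandra parameters) applies. This is "`π` unitary ⟹
`π_∞ ≅ π̄_∞^∨`" read on infinitesimal characters: Clozel 1990, Lemme 4.9 with weight `0`;
Knapp–Vogan 1995, Ch. IX §1. [cite: Clozel1990, Lemme 4.9] [cite: KnappVogan1995, Ch. IX §1 (p. 597)] -/
theorem CuspidalAutomorphicRepData.archParameter_map_neg_conj_of_clean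
    (π : CuspidalAutomorphicRepData n K hcpt) (hW' : π.1.W' = ⊥)
    (hAG : ∀ φ ∈ π.1.W, ∀ z ∈ (AdelicGroupData.gl n K).center', ∀ g, φ (z * g) = φ g)
    {χ : (K →+* ℂ) → Multiset ℂ} (hχ : π.1.HasArchParameter χ) (σ : K →+* ℂ) :
    χ (ComplexEmbedding.conjugate σ) = (χ σ).map fun a ↦ -conj a := by
  classical
  obtain ⟨ρ𝔤, hρ, hχ'⟩ := hχ
  -- the automorphic measure and the Petersson pairing on bounded invariant functions
  obtain ⟨μ, hμ⟩ := AdelicGroupData.exists_isAutomorphicMeasure_gl_holds n K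
  have hWS : π.1.W ≤ (AdelicGroupData.gl n K).bddInvariant :=
    AutomorphicRepsGL.le_bddInvariant_of_cuspidal_bounded
      (AutomorphicRepsGL.cuspidal_bounded_holds (hcpt := hcpt)) π.2 hAG
  -- `W ≅ W / ⊥`
  have hker : π.1.kerQuot = ⊥ := by
    rw [AutomorphicRepData.kerQuot, hW', Submodule.comap_bot, Submodule.ker_subtype]
  have hinj : Function.Injective π.1.mkQ := by
    rw [← LinearMap.ker_eq_bot]
    exact (Submodule.ker_mkQ _).trans hker
  let e : π.1.W ≃ₗ[ℂ] π.1.Quot :=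
    LinearEquiv.ofBijective π.1.mkQ ⟨hinj, Submodule.mkQ_surjective _⟩
  have he : ∀ w : π.1.W, e w = π.1.mkQ w := fun w ↦ rfl
  -- the Lie action on `W / ⊥` is the Lie derivative on `W`
  have hact : ∀ (X : (AutomorphyDatum.gl n K hcpt).arch.lie) (q : π.1.Quot),
      e.symm (ρ𝔤 X q) = π.1.lieDerivW X (e.symm q) := by
    intro X q
    apply e.injective
    rw [e.apply_symm_apply, he, ← hρ X (e.symm q), ← he, e.apply_symm_apply]
  -- the form on `W / ⊥`
  let B : π.1.Quot → π.1.Quot → ℂ := fun q q' ↦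
    (AdelicGroupData.gl n K).l2Pairing μ ((e.symm q : π.1.W) : (AdelicGroupData.gl n K).Adelic → ℂ)
      ((e.symm q' : π.1.W) : (AdelicGroupData.gl n K).Adelic → ℂ)
  have hmem : ∀ q : π.1.Quot, ((e.symm q : π.1.W) : (AdelicGroupData.gl n K).Adelic → ℂ) ∈
      (AdelicGroupData.gl n K).bddInvariant := fun q ↦ hWS (e.symm q).2
  have hadd₁ : ∀ u v w, B (u + v) w = B u w + B v w := fun u v w ↦ by
    simp only [B, map_add, Submodule.coe_add]
    exact AdelicGroupData.l2Pairing_add_left (hmem u) (hmem v) (hmem w)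
  have hsmul₁ : ∀ (c : ℂ) v w, B (c • v) w = c * B v w := fun c v w ↦ by
    simp only [B, map_smul, Submodule.coe_smul]
    exact AdelicGroupData.l2Pairing_smul_left c _ _
  have hsymm : ∀ v w, conj (B v w) = B w v := fun v w ↦ AdelicGroupData.l2Pairing_conj_symm _ _
  have hadd₂ : ∀ u v w, B u (v + w) = B u v + B u w := fun u v w ↦ by
    rw [← hsymm, hadd₁, map_add, hsymm, hsymm]
  have hsmul₂ : ∀ (c : ℂ) v w, B v (c • w) = conj c * B v w := fun c v w ↦ by
    rw [← hsymm, hsmul₁, map_mul, hsymm]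
  -- `𝔤` acts by skew-Hermitian operators
  have hskew : ∀ (X : (AutomorphyDatum.gl n K hcpt).arch.lie) (v w : π.1.Quot),
      B (ρ𝔤 X v) w = -B v (ρ𝔤 X w) := by
    intro X v w
    simp only [B, hact]
    have h := (AutomorphyDatum.gl n K hcpt).l2Pairing_lieDeriv_add_eq_zero (μ := μ) X (hmem v) (hmem w)
      (π.1.stable.isArchSmooth (e.symm v).2) (π.1.stable.isArchSmooth (e.symm w).2)
      (hWS (π.1.stable.lie_stable X _ (e.symm v).2)) (hWS (π.1.stable.lie_stable X _ (e.symm w).2))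
    exact eq_neg_of_add_eq_zero_left h
  -- a vector with `⟪φ, φ⟫ ≠ 0`
  obtain ⟨φ₀, hφ₀W, hφ₀W'⟩ := SetLike.exists_of_lt π.1.lt
  have hφ₀ : φ₀ ≠ 0 := fun h0 ↦ hφ₀W' (by rw [h0]; exact Submodule.zero_mem _)
  have hv : B (e ⟨φ₀, hφ₀W⟩) (e ⟨φ₀, hφ₀W⟩) ≠ 0 := by
    simp only [B, e.symm_apply_apply]
    exact fun h0 ↦ hφ₀ (AdelicGroupData.eq_zero_of_l2Pairing_self_eq_zero (hWS hφ₀W) h0)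
  exact hχ'.map_neg_conj_of_skewHermitian B hadd₁ hadd₂ hsmul₁ hsmul₂ (fun Y v w ↦ hskew ⟨Y, trivial⟩ v w)
    hv σ

end Clean

/-! ### Purity of a cuspidal representation with a `C`-algebraic infinity type -/

section Purity

omit [NumberField K] in
/-- The `a`-exponents of a `C`-algebraic infinity type are real. [folklore] -/
theorem InfinityType.IsCAlgebraic.conj_a {T : InfinityType K n} (hC : T.IsCAlgebraic)
    (ι : K →+* ℂ) {p : ArchWeight} (hp : p ∈ T ι) : conj p.a = p.a := by
  obtain ⟨k, l, hk, -⟩ := hC ι p hp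
  rw [hk]
  simp only [map_add, map_intCast, map_div₀, map_sub, map_natCast, map_one, map_ofNat]

/-- **Clozel's purity lemma on multisets (Lemme 4.9), unconditionally.** Let `π` be a cuspidal
automorphic representation of `GL_n(𝔸_K)` (`n ≥ 1`) with an infinity type `T` that is
`C`-algebraic (`a, b ∈ (n-1)/2 + ℤ`). Then there is an integer `w` with
`{a-multiset of T at σ̄} = {w - a : a ∈ a-multiset of T at σ}` for every complex embedding `σ` —
clause (iii) of `Clozel1990_regularAlgebraic` for `π` (there under the stronger hypothesis
"regular algebraic"). Proof ("`π` cuspidale ⟹ `π ⊗ |det|^{w/2}` unitaire", Clozel 1990, Lemme 4.9;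
Patrikis 2019, proof of Cor. 3.2.3): pass to a clean model `π₀` with the same archimedean parameter
(`exists_clean_hasSatakeParamAt_hasArchParameter_of_sSup_irreducible` with the proved semisimplicity
`stable_cuspidal_eq_sSup_irreducible_holds`); `A_G` acts on it by `a ↦ a^s`, `s = ∑_σ ∑_i a_{σ,i}`
(`HasInfinityType.apply_posRealScalar_mul_of_W'_eq_bot`: `γ(1) = ∑ x`), and `s` is real (`C`-algebraic);
the real twist `π₁ = π₀ ⊗ |det|^{s₁}`, `s₁ = -s/(n[K:ℚ])`, is a clean `A_G`-invariant cuspidal datum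
(`exists_cuspidalAutomorphicRepData_map_mulChar_detTwist`, `mulChar_detTwist_apply_posRealScalar_mul_of_cpow`)
with archimedean parameter `χ + s₁` (`HasArchParameter.of_map_mulChar_detTwist`); by
`archParameter_map_neg_conj_of_clean` (the Petersson pairing, unitarity on infinitesimal
characters) `{a(σ̄) + s₁} = {-(a(σ) + s₁)}`, i.e. `{a(σ̄)} = {w - a(σ)}` with `w = -2s₁`; and
`w ∈ ℤ` because `w = a + a'` for some `a, a' ∈ (n-1)/2 + ℤ`.
[cite: Clozel1990, Lemme 4.9] [cite: Patrikis2019, Cor. 3.2.3 (arXiv:1207.6724)] -/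
theorem CuspidalAutomorphicRepData.purity_of_hasInfinityType [NeZero n]
    (π : CuspidalAutomorphicRepData n K hcpt) {T : InfinityType K n}
    (hT : π.1.HasInfinityType T) (hC : T.IsCAlgebraic) :
    ∃ w : ℤ, ∀ ι : K →+* ℂ, (T ((starRingEnd ℂ).comp ι)).map ArchWeight.a =
      ((T ι).map ArchWeight.a).map fun a ↦ (w : ℂ) - a := by
  classical
  -- (1) a clean model with the same archimedean parameter, on which `A_G` acts by `a ↦ a^s`
  obtain ⟨π₀, h0, -, harch⟩ :=
    π.exists_clean_hasSatakeParamAt_hasArchParameter_of_sSup_irreducible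
      AutomorphicRepsGL.stable_cuspidal_eq_sSup_irreducible_holds
  have hT₀ : π₀.1.HasInfinityType T := ⟨hT.1, harch _ hT.2⟩
  obtain ⟨s, hs⟩ : ∃ s : ℂ, (∑ ι : K →+* ℂ, ((T ι).map ArchWeight.a).sum) = s := ⟨_, rfl⟩
  have hAG₀ : ∀ φ ∈ π₀.1.W, ∀ (t : ℝ≥0ˣ) (g : (AdelicGroupData.gl n K).Adelic),
      φ ((show (AdelicGroupData.gl n K).Adelic from posRealScalar n K t) * g) =
        (((t : ℝ≥0) : ℝ) : ℂ) ^ s * φ g := by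
    intro φ hφ t g
    rw [← hs]
    exact hT₀.apply_posRealScalar_mul_of_W'_eq_bot h0 hφ t g
  -- (2) `s` is real (`C`-algebraic exponents are real)
  have hreal : ∀ ι : K →+* ℂ, ∀ a ∈ (T ι).map ArchWeight.a, conj a = a := by
    intro ι a ha
    obtain ⟨p, hp, rfl⟩ := Multiset.mem_map.1 ha
    exact hC.conj_a ι hp
  have hs_conj : conj s = s := by
    rw [← hs, map_sum]
    refine Finset.sum_congr rfl fun ι _ ↦ ?_
    rw [map_multiset_sum, Multiset.map_congr rfl (hreal ι), Multiset.map_id']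
  have hs_re : ((s.re : ℝ) : ℂ) = s := Complex.conj_eq_iff_re.1 hs_conj
  -- (3) the real twist `π₁ = π₀ ⊗ |det|^{s₁}`, `s₁ = -s / (n [K:ℚ])`: clean, `A_G`-invariant, parameter `χ + s₁`
  have hnd : ((n * Module.finrank ℚ K : ℕ) : ℂ) ≠ 0 := by
    exact_mod_cast Nat.mul_ne_zero (NeZero.ne n) Module.finrank_pos.ne'
  obtain ⟨s₁, hs₁⟩ : ∃ s₁ : ℝ, s₁ = -s.re / (n * Module.finrank ℚ K : ℕ) := ⟨_, rfl⟩
  have hs₁' : ((s₁ : ℝ) : ℂ) * ((n * Module.finrank ℚ K : ℕ) : ℂ) = -s := by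
    rw [hs₁, Complex.ofReal_div, Complex.ofReal_neg, Complex.ofReal_natCast, div_mul_cancel₀ _ hnd,
      hs_re]
  obtain ⟨η, hη⟩ := exists_heckeCharacter_ideleNorm_cpow (K := K) ((s₁ : ℝ) : ℂ)
  obtain ⟨π₁, hW₁, hW₁'⟩ := exists_cuspidalAutomorphicRepData_map_mulChar_detTwist hη π₀
  have h1 : π₁.1.W' = ⊥ := by rw [hW₁', h0, Submodule.map_bot]
  have hAG₁ : ∀ φ ∈ π₁.1.W, ∀ z ∈ (AdelicGroupData.gl n K).center', ∀ g, φ (z * g) = φ g := by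
    rw [hW₁]
    rintro _ ⟨ψ, hψ, rfl⟩ z hz g
    obtain ⟨t, rfl⟩ := hz
    exact mulChar_detTwist_apply_posRealScalar_mul_of_cpow hη hs₁' (hAG₀ ψ hψ) t g
  have hχ₁ : π₁.1.HasArchParameter fun σ ↦ ((T σ).map ArchWeight.a).map (· + ((s₁ : ℝ) : ℂ)) :=
    AutomorphicRepData.HasArchParameter.of_map_mulChar_detTwist hη hW₁ hW₁' hT₀.2
  -- (4) Hermitian symmetry of the twisted parameter: `{a(σ̄) + s₁} = {-(a(σ) + s₁)}`
  have hherm := fun σ : K →+* ℂ ↦ π₁.archParameter_map_neg_conj_of_clean h1 hAG₁ hχ₁ σ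
  -- (5) the weight `w = -2 s₁`: `{a(σ̄)} = {w - a(σ)}`
  obtain ⟨w, hw⟩ : ∃ w : ℂ, w = -2 * ((s₁ : ℝ) : ℂ) := ⟨_, rfl⟩
  have hconj : ∀ ι : K →+* ℂ, ComplexEmbedding.conjugate ι = (starRingEnd ℂ).comp ι := fun ι ↦
    RingHom.ext fun x ↦ ComplexEmbedding.conjugate_coe_eq ι x
  have key : ∀ ι : K →+* ℂ, (T ((starRingEnd ℂ).comp ι)).map ArchWeight.a =
      ((T ι).map ArchWeight.a).map fun a ↦ w - a := by
    intro ι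
    have h := congrArg (Multiset.map fun a : ℂ ↦ a - ((s₁ : ℝ) : ℂ)) (hherm ι)
    simp only [Multiset.map_map, Function.comp_def, add_sub_cancel_right] at h
    rw [← hconj, h, Multiset.map_map]
    refine Multiset.map_congr rfl fun p hp ↦ ?_
    rw [Function.comp_apply, map_add, Complex.conj_ofReal, hC.conj_a ι hp, hw]
    ring
  -- (6) `w ∈ ℤ`: `w = a + a'` with `a ∈ T(ι₀)`, `a' ∈ T(ῑ₀)`, both in `(n-1)/2 + ℤ`
  obtain ⟨ι₀⟩ : Nonempty (K →+* ℂ) :=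
    Fintype.card_pos_iff.1 (by rw [NumberField.Embeddings.card K ℂ]; exact Module.finrank_pos)
  have hcard : Multiset.card ((T ι₀).map ArchWeight.a) = n := by
    rw [Multiset.card_map, hT.1.1 ι₀]
  obtain ⟨a₀, ha₀⟩ := Multiset.card_pos_iff_exists_mem.1
    (by rw [hcard]; exact Nat.pos_of_ne_zero (NeZero.ne n))
  have ha₀' : w - a₀ ∈ (T ((starRingEnd ℂ).comp ι₀)).map ArchWeight.a := by
    rw [key ι₀]
    exact Multiset.mem_map_of_mem _ ha₀
  obtain ⟨p, hp, hpa⟩ := Multiset.mem_map.1 ha₀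
  obtain ⟨p', hp', hp'a⟩ := Multiset.mem_map.1 ha₀'
  obtain ⟨k, l, hk, -⟩ := hC ι₀ p hp
  obtain ⟨k', l', hk', -⟩ := hC _ p' hp'
  have hwint : w = ((k + k' + ((n : ℤ) - 1) : ℤ) : ℂ) := by
    have e1 : w = p'.a + a₀ := by
      rw [hp'a]
      ring
    rw [e1, ← hpa, hk, hk']
    push_cast
    ring
  refine ⟨k + k' + ((n : ℤ) - 1), fun ι ↦ ?_⟩
  rw [← hwint]
  exact key ι

/-- **Clause (iii) of `Clozel1990_regularAlgebraic`, proved**: for every cuspidal `π` on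
`GL_n(𝔸_K)` (`n ≥ 1`) and every regular algebraic infinity type `T` of `π` there is `w ∈ ℤ` with
`{a at σ̄} = {w - a : a at σ}` at every embedding (regularity is not used:
`purity_of_hasInfinityType`). Clozel 1990, Lemme 4.9. [cite: Clozel1990, Lemme 4.9] -/
theorem CuspidalAutomorphicRepData.clause_iii [NeZero n] (π : CuspidalAutomorphicRepData n K hcpt)
    (T : InfinityType K n) (hT : π.1.HasInfinityType T) (hreg : T.IsRegularAlgebraic) :
    ∃ w : ℤ, ∀ ι : K →+* ℂ, (T ((starRingEnd ℂ).comp ι)).map ArchWeight.a =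
      ((T ι).map ArchWeight.a).map fun a ↦ (w : ℂ) - a :=
  π.purity_of_hasInfinityType hT hreg.1

/-- Clause (iii) in rank `0` (both sides are empty multisets). [folklore] -/
theorem CuspidalAutomorphicRepData.clause_iii_rank_zero {hcpt : isCompact_glFiniteIntegralLevel 0 K}
    (π : CuspidalAutomorphicRepData 0 K hcpt) (T : InfinityType K 0) (hT : π.1.HasInfinityType T) :
    ∃ w : ℤ, ∀ ι : K →+* ℂ, (T ((starRingEnd ℂ).comp ι)).map ArchWeight.a =
      ((T ι).map ArchWeight.a).map fun a ↦ (w : ℂ) - a := by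
  refine ⟨0, fun ι ↦ ?_⟩
  have h1 : T ((starRingEnd ℂ).comp ι) = 0 := Multiset.card_eq_zero.1 (hT.1.1 _)
  have h2 : T ι = 0 := Multiset.card_eq_zero.1 (hT.1.1 _)
  rw [h1, h2, Multiset.map_zero, Multiset.map_zero]

end Purity

end SecondRoute

/-! ### The named fact from Clozel's Thm. 3.13 proper: clauses (i) and (ii) suffice -/

section Fact

open _root_.NumberField

variable {n : ℕ} {K : Type} [Field K] [NumberField K] {hcpt : isCompact_glFiniteIntegralLevel n K}

/-- **Clause (iv) for one `π` from clauses (i) and (ii)** (`n ≥ 1`): `ℚ(π_f)` is totally real or CM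
as soon as it is a number field and the cuspidal `Aut(ℂ)`-conjugates with conjugate infinity types
exist — `isTotallyReal_or_isCMField_ratField_of_clauses` (`ClozelAlgebraicityCMAssemblyProofs`)
with clause (iii) supplied by `purity`. (Patrikis 2019, Cor. 3.2.3 from Clozel 1990, Thm. 3.13 and
Lemme 4.9.) [cite: Patrikis2019, Cor. 3.2.3 (arXiv:1207.6724)] [cite: Clozel1990, Thm. 3.13 and Lemme 4.9] -/
theorem CuspidalAutomorphicRepData.isTotallyReal_or_isCMField_ratField_of_clauses_i_ii [NeZero n]
    (π : CuspidalAutomorphicRepData n K hcpt) (hπ : π.1.IsRegularAlgebraic)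
    (hi : FiniteDimensional ℚ (ratField π.1))
    (hii : ∀ σ : ℂ ≃ₐ[ℚ] ℂ, ∃ π' : CuspidalAutomorphicRepData n K hcpt,
      IsAutConjugate σ π.1 π'.1 ∧
      ∀ T : InfinityType K n, π.1.HasInfinityType T → T.IsRegularAlgebraic →
        ∃ T' : InfinityType K n, π'.1.HasInfinityType T' ∧
          ∀ ι : K →+* ℂ, (T' ι).map ArchWeight.a = (T.autConj σ ι).map ArchWeight.a) :
    IsTotallyReal (ratField π.1) ∨ IsCMField (ratField π.1) :=
  π.isTotallyReal_or_isCMField_ratField_of_clauses hπ hi hii fun _ hT hreg ↦ π.purity hT hreg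

/-- **`Clozel1990_regularAlgebraic` follows from its clauses (i) and (ii)** — i.e. from Clozel
1990, Thm. 3.13 proper: `ℚ(π_f)` is a number field and the cuspidal `Aut(ℂ)`-conjugates `^σπ` with
infinity types `^σT` exist. Clause (iii) (archimedean purity on multisets, Lemme 4.9) is the theorem
`CuspidalAutomorphicRepData.purity` of this file, and clause (iv) (`ℚ(π_f)` totally real or CM,
Patrikis 2019, Cor. 3.2.3) follows from (i)–(iii) by `Clozel1990_regularAlgebraic_of_clauses`
(`ClozelAlgebraicityCMAssemblyProofs`). What remains of the named fact is the `ℚ`-structure of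
cuspidal cohomology behind (i) and (ii).
[cite: Clozel1990, Thm. 3.13 and Lemme 4.9] [cite: Patrikis2019, Cor. 3.2.3 (arXiv:1207.6724)] -/
theorem Clozel1990_regularAlgebraic_of_clauses_i_ii
    (h : ∀ (n : ℕ) (K : Type) [Field K] [NumberField K] (hcpt : isCompact_glFiniteIntegralLevel n K)
      (π : CuspidalAutomorphicRepData n K hcpt), π.1.IsRegularAlgebraic →
      FiniteDimensional ℚ (ratField π.1) ∧
      (∀ σ : ℂ ≃ₐ[ℚ] ℂ, ∃ π' : CuspidalAutomorphicRepData n K hcpt,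
        IsAutConjugate σ π.1 π'.1 ∧
        ∀ T : InfinityType K n, π.1.HasInfinityType T → T.IsRegularAlgebraic →
          ∃ T' : InfinityType K n, π'.1.HasInfinityType T' ∧
            ∀ ι : K →+* ℂ, (T' ι).map ArchWeight.a = (T.autConj σ ι).map ArchWeight.a)) :
    Clozel1990_regularAlgebraic := by
  refine Clozel1990_regularAlgebraic_of_clauses fun n K _ _ hcpt π hπ ↦ ?_
  obtain ⟨hi, hii⟩ := h n K hcpt π hπ
  exact ⟨hi, hii, fun _ hT hreg ↦ π.purity hT hreg⟩

end Fact

end Literature.NumberTheory.Automorphic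

end
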